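import Summits.Schanuel.Schanuel.Theorems.RootDecomp1KDigitPincer03

/-!
# RootDecomp1KSectorTheorem — lens 1, generation 67, NODE 27 «THE SECTOR THEOREM BY ONE NEWTON STEP AT (∞,∞) — THE EDGE ENGINE» — FORK (B): the FIRST-ORDER SECTOR THEOREM at FLOOR F (`thinFibreAt_of_sectorCond : c k ≠ 0 → DomZero k c → SectorCond m₀ k c → ThinFibreAt m₀ (xPolyP k c)`, every m₀ / k / monomial support, the only escape the typed residue `Residue m₀ k c`; one PROVED Diophantine input `Ridout.padicRoth_int`; CLAIM L3031, PRICE L3032, ADDENDUM L3037, RULE K-R58, NODE L3047, VERDICT L3050) — part 1 (RootDecomp1KSectorTheorem01): §1  The typed objects: weights, the edge polynomial, the edge data, the sector condition, the residue · §2  Helpers · §3  The point `(∞,∞)`: the ultrametric TIE names the slope EXACTLY — 20 declarations `dMax` … `two_zpow_inj`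

(lens-1 g67 NODE 27 «THE SECTOR THEOREM BY ONE NEWTON STEP AT (∞,∞) — THE EDGE ENGINE» L3047: HOME kernel K = HOME/decomp-schanuel-lens-1/g67/lean/SectorTheorem.lean sha256 bbe43d14…, 2869 l, ONE namespace `Summit.Schanuel.Schanuel.Theorems.RootDecomp1KSectorTheorem`, imports the tree port …RootDecomp1KDigitPincer03 ONLY (node 26's record port; its closure holds every cell file used); no private / instance / set_option / notation / sorry / new axiom / binder / `decide` on levels; lens farm rc 0 · 0 errors · 0 sorries · warnings dupNamespace only, `--axioms` standard on the 18 deciding declarations, Probe rc 0 (g67/out/); memo g67/NODE-g67.md; CLAIM L3031 (ASK-FIRST under K-R57 (iii)); crit g12 PRICE L3032 (fork (A) ×0-AS-RECORD as posted / fork (B) a kernel meeting FLOOR F = «FIRST-ORDER SECTOR THEOREM» = THEOREM ×1 consuming K-R57 (iii); CHECKLIST K-g67 F1–F6 + S1–S8; RULE K-R58 PRE-ANNOUNCED) and PRICE ADDENDUM L3037 ((F6′) `W4P` by tree name; the ρ3 specimen `x² + x·Y² + Y⁵ + 3` of writer NOTE 17 L3036 = the F5 exhibit); census instruments LIVENESS-v36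 (key edge) / v37 (key ls2); crit g12 VERDICT L3050 (2026-09-02T03:35Z): THEOREM ×1 GRANTED under K-R57 (iii) for FORK (B) = the FIRST-ORDER SECTOR THEOREM AT FLOOR F (F1 F2 F3 (T) F4(α) F4(β) F5 F6 F6′ R-27-i and CHECKLIST S1–S8 met on the critic's own farm runs), the single ×1 of the sector line CONSUMED (K-R58 (i): no further ×1 on this line), TALLY lens-1 ×22 + THEOREM ×24, RULE K-R58 FIXED (PRICE L3032 (i)–(v) verbatim with the ADDENDUM L3037 gloss; W-27-2 = a ×0 wish for typed stratum predicates), PORT GO → census-1 (this port; PORT IDENTITY 27 owed by the seated critic). Port by census-1 gen 25 as `RootDecomp1KSectorTheorem01–10` (files ≤ 400 lines; `--supports stmt-Schanuel-33364`, the item stays OPEN; no census credit carried; RULE K-R58 (iv): UNCONDITIONAL PART ∪= these names): 01 = K l.1–307 of the prepped source (opens §1 / §2 / §3) — 20 decls `dMax`, `box`, `supp`, …, `two_zpow_inj`; 02 = K l.308–570 of the prepped source (opens §4) — 5 decls `far_pair`, `natDegree_le_dMax`, `norm_pow_sub_one_le`, …, `mem_supp`; 03 = K l.571–896 of the prepped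 source (opens §4b / §5) — 12 decls `layered_bound`, `edge_bound_one`, `edge_bound_crude`, …, `tendsto_partialSum_two`; 04 = K l.897–1221 of the prepped source (opens §6 / §7) — 10 decls `arch_finite`, `ridout_two`, `lt_rpow_neg_of_pow_mul_pow_lt`, …, `factorial_pred_le_div`; 05 = K l.1222–1500 of the prepped source (opens §8) — 4 decls `pair_levels_finite`, `dvd_lc_pow_val`, `den_le_of_dvd`, `den_rescaled_le`; 06 = K l.1501–1822 of the prepped source (opens §9) — 13 decls `size_regime`, `c_zero_ne_zero`, `far_levels_finite`, …, `sum_range_ite_shift`; 07 = K l.1823–2080 of the prepped source (inside §9) — 14 decls `layerPoly_lin2`, `layer0_lin2`, `layer1_lin2`, …, `natDegree_scaleShift`; 08 = K l.2081–2401 of the prepped source (opens §10) — 18 decls `thinFibreAt_xLinear`, `thinFibreAt_xPolyP_one`, `edgeGood_of_gap`, …, `thinFibreAt_M_sector`; 09 = K l.2402–2627 of the prepped source (opens §11) — 17 decls `sectorCond_beta0_example`, `thinFibreAt_beta0_example`, `thinFibreAt_generic_xLinear_example`, …, `rho2_two`; 10 = K l.2628–2905 of the prepped source (opens §12) — 13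 decls `residue_rho2`, `rho3`, `rho3_zero`, …, `W4P_eq`. 39 one-line docstrings synthesised for undocumented helper declarations (statements quoted, census port convention since gen 22); everything else = K VERBATIM (statements, names, proofs, K's module docstring kept in part 01 below this provenance block).)
-/

/-!
# RootDecomp1KSectorTheorem — lens 1, generation 67, NODE 27 «THE SECTOR THEOREM BY ONE NEWTON STEP AT (∞,∞) —
THE EDGE ENGINE» (CLAIM L3031 · PRICE L3032 (fork (A)/(B), FLOOR F, CHECKLIST S, RULE K-R58 pre-announced) ·
ADDENDUM L3037 (F6′, the ρ3 specimen, R-27-i)) — **FORK (B): the FIRST-ORDER SECTOR THEOREM at FLOOR F**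

HOME kernel `K = HOME/decomp-schanuel-lens-1/g67/lean/SectorTheorem.lean`, ONE namespace
`Summit.Schanuel.Schanuel.Theorems.RootDecomp1KSectorTheorem`, imports the tree port `…RootDecomp1KDigitPincer03`
ONLY (node 26's record port; its closure holds every cell file used).  Tree facts BY NAME: `ThinFibreAt` (DegreeLadder06
l.77), `bev`, `bev_eq_sum`, `continuous_bev₂` (DegreeLadder01/02), `xPolyP`, `bev_xPolyP`, `xPolyP_one`, `level_identity`
(XTop01), `xLinP`, `bev_xLinP`, `norm_ratCast_two`, `norm_ratCast_of_le`, `norm_psNumer_sub_one` (XLinear02/03),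
`norm_aeval_le`, `norm_psNumer` (XLinearII01), `norm_ratCast_le_den` (XTop02), `roots_data_mult` (XAll01), `norm_two_pow_Cp`,
`exists_pos_le_norm_ratCast_sub`, `nearest_root_sharp`, `rootMult`, `xPolyP_ne_zero` (LocalExponent01/03), `DomZero`,
`den_dvd_of_level`, `den_le_of_level`, `levels_finite_of_bounded` (Integrality01), `LevelSet`, `LevelFinite`
(LevelFinite01), `psNumer`, `partialSum_eq_psNumer_div`, `coprime_psNumer` (TwoBaseCell), `partialSum_two_strictMono`,
`abs_liouvilleNumber_two_sub_partialSum` (RelLiouvilleCell03), `pTwo` (DegreeLadder08), the terms `xc`/`XP`/`X6P`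
(DigitPincer01, node 26), `mQ`/`mC`/`M` (HyperellipticSiegel03, node 23), `W4P`/`w4C`/`vG` (OddEmpty03).  THE ONE
DIOPHANTINE INPUT is the tree's PROVED `Literature.NumberTheory.DiophantineApproximation.Ridout.padicRoth_int`
(sorry-free, K-R47), entering ONCE through `ridout_two` (`S = {2}`); the transcendence of `ℓ₂` is MATHLIB's
`liouville_liouvilleNumber` + `Liouville.transcendental` (`transcendental_ell2`; the bridge is the identity — the tree's
`partialSum 2 N` IS Mathlib's `LiouvilleNumber.partialSum 2 N`, its rate `abs_liouvilleNumber_two_sub_partialSum` gives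
`tendsto_partialSum_two`); Mathlib's `hensels_lemma` enters ONLY the residue EXHIBITS of §11 (`17^{1/4}, √17 ∈ ℚ₂`),
never the engine.  No `private`, no `instance`, no `set_option`, no notation, no sorry, no new axiom, no binder, no
`decide` on levels; axioms {propext, Classical.choice, Quot.sound} (Probe).

## WHICH FORK.  (B).  FLOOR F item by item

(F1) ENGINE hypothesis-free: `thinFibreAt_of_sectorCond (k) (c) (hB : c k ≠ 0) (hdom : DomZero k c)
(hS : SectorCond m₀ k c) : ThinFibreAt m₀ (xPolyP k c)` — EVERY `m₀`, EVERY `k`, EVERY monomial support; no other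
binder (§8).  (F2) RELEVANT ROOTS ONLY: `EdgeGood`'s root clause reads `∀ β : ℂ₂, β ≠ 0 → f(β) = 0 → RootGood … β`
(§1); the rescaled far point is a `2`-adic unit up to `2^{±|Δ|}` (`far_pair`), so `β = 0` is never nearest
(`pair_levels_finite`, case `β = 0`: `‖W‖ ≥ Rlo`).  (F3) ONE CONSTANT CORRECTION ABSORBED: `RootGood`'s branch (R) —
at a SIMPLE non-zero root `β` the condition is `s < G_eff(β) := min{g ≥ 1 : f_g(β) ≠ 0}` and `s < q` (typed as
`∃ L, (∀ g, 1 ≤ g → g < L → f_g(β) = 0) ∧ s < L ∧ s < q`); multiple roots keep the crude branch (C) (`μ·s < min(L, q)`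
with the layers `f_1 … f_{L−1}` vanishing identically); the proof of (R) is `refined_root` (`‖f(W)‖ = ‖f'(β)‖·‖W − β‖`
EXACTLY near `β`) + `layered_bound` at depth `L` + the Lipschitz lemma `norm_eval_sub_le`, then RIDOUT with exponent
`1` (§4b, §7); (T) `thinFibreAt_of_transport` (§9).  (F4) COROLLARIES BY NAME: (α) `thinFibreAt_xLinear (A B : ℤ[X])
(hB : B ≠ 0) (hdeg : B.natDegree + 2 ≤ A.natDegree) (m₀) : ThinFibreAt m₀ (xLinP A B)` and `thinFibreAt_xPolyP_one`
(the `xPolyP 1 c` spelling) — NO further hypothesis: the canonical affine shift `Y ↦ (Y + a)/b`,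
`b = K₀²`, `a = −Δ₀·K₀` (`K₀ = (d − e)·a_d·b_e`, `Δ₀ = a_{d−1}·b_e − a_d·b_{e−1}`) makes the sub-leading pair
PROPORTIONAL (`a_{d−1}·b_e = a_d·b_{e−1}`; `scaleShift`, `coeff_scaleShift_pred`), and for a proportional pair the
edge data in the frame `(s, q) = (1, d − e)` are `f = W^e·(a_d·W^{d−e} + b_e)` (non-zero roots SIMPLE) and
`f_1 = W^{e−1}·(a_{d−1}·W^{d−e} + b_{e−1})`, so `f_1(β) = 0` at EVERY edge root `a_d·β^{d−e} = −b_e`, i.e. (R) holds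
with `L = 2 > s = 1`, `q = d − e ≥ 2 > s` (`edgeGood_lin2`, `sectorCond_lin2`; no recursion, no `A(c) = B(c) = 0`
split is needed: (R) asks nothing about `β ∈ ℚ₂`); (β) `thinFibreAt_XP_sector (b c : ℤ)
(m₀) : ThinFibreAt m₀ (XP b c)` — node 26's WHOLE pencil `x³ + b·x·Y + Y⁷ + c` incl. `thinFibreAt_X6P_sector` (no digit
chain, no parity of `b`), and `thinFibreAt_M_sector (j : ℤ) (m₀) : ThinFibreAt m₀ (xPolyP 2 (mC j))` — node 23's WHOLE
family incl. `M 67` WITHOUT `hyperellipticSiegel` (§10, by the pure-gap inspection lemma `edgeGood_of_gap`).  (F5) TYPED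
RESIDUE `Residue m₀ k c := ¬ SectorCond m₀ k c`, decided by finitely many data (docstring of `Residue` = the inspection
recipe), THREE STRATA WITH ONE MEMBER EACH, PROVED MEMBERS: `residue_rho1` (`Y⁴ + x·Y − 17x²`, `m₀ ≤ 2`; SUBSPACE),
`residue_rho2` (`(Y² − 17x)² − x·Y`; MULTIPLE), `residue_rho3` (`x² + x·Y² + Y⁵ + 3`, the writer's specimen, ADDENDUM
L3037 (2); PEELABLE-DEEP) (§11); «FIRST ORDER: one Newton step + one constant correction».  (F6) PROBE
(`HOME/…/g67/lean/Probe.lean`): the typed predicate evaluated BY NAME on `X6P`, `M 67`, ρ1, ρ2, ρ3, the `β = 0` example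
`Y⁴ + Y³ + x(Y² + Y + 1)` (`sectorCond_beta0_example`, decided), the generic `x`-linear member `A = Y⁴ + 2Y³`,
`B = −17(Y² + 3Y)` (`thinFibreAt_generic_xLinear_example`, decided via (α)); (F6′) `not_domZero_w4C`, `W4P_eq`: the standing
witness `W4P` of record (tree `RootDecomp1KOddEmpty.W4P`) is `¬DomZero` ⇒ OUTSIDE the sector.  (R-27-i, welcome item)
`levelFinite_of_thinFibreAt_zero`, `levelFinite_of_sectorCond_zero`, `levelFinite_xLinear`, `levelFinite_XP_sector`,
`levelFinite_M_sector` (§12).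

## THE ENGINE (E1)–(E7) and where each lives

(E1) `far_pair` (§3): for `N ≥ N₁` a level point `r` beyond the `2`-adic radius `R₀` TIES two terms of the weight-sorted
level identity (`level_identity`, `ultrametric_tie`): a HULL PAIR `j₁ < j₂` with
`(d₁ − d₂)·log₂‖r‖₂ = (j₂ − j₁)·N! + (v₂ lc₁ − v₂ lc₂)` EXACTLY (`q·E = s·N! + Δ`, `|Δ| ≤ V`), and no leading monomial
above the pair.  (E2) `size_regime` + `den_rescaled_le` (§8): `den r ≥ ‖r‖₂`-part, so a NON-violating slope
(`m₀·s ≥ q + 1`) contradicts `den(r)^{m₀N} ≤ C·2^{(N+1)!}` for `N` large — the critical slope `m₀·s = q` is VIOLATING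
and goes to the engine.  (E3) `layered_bound` (§4): ONE NEWTON STEP — with `N! = q·n` and `W = r·2^{s·n}`,
`‖Σ_{g<L} 2^{ng} f_g(W)‖₂ ≤ max(1,‖W‖)^{D}·(2^{−Ln} + 2^{−(N! − (N−1)!)})`; the second term is the DIGIT CEILING
`p_N ≡ 1 (mod 2^{N!−(N−1)!})` (`norm_psNumer_sub_one`), and `N! − (N−1)! = q·n·(1 − 1/N) < q·n` is WHY the `q` in
`s < min(G_eff, q)` cannot be removed (ρ2-type members `μ = 2, s = 1, q = 2` fail by the digit, not by a monomial).
(E4) `nearest_root_sharp` (tree) puts `W` next to a root `β` of `f` with its multiplicity; `β = 0` is impossible, `β ∉ ℚ₂`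
is the closed range `exists_pos_le_norm_ratCast_sub`; (C)/(R) as in (F3).  (E5) `ridout_levels_finite` (§7): RIDOUT at
the place `2` (`ridout_two`) for the INTEGERS `Dn!·W` (`den W ≤ Dn` from `den_rescaled_le`, i.e. `den_dvd_of_level` —
the only place `DomZero` and `c₀ ≠ 0` enter) against the algebraic `Dn!·β`, `|Dn!·W| ≤ C′·2^{sn}`, exponent from
`μ·s + 1 ≤ min(G, q)` STRICT (`decay_bound`, `exp_arith`); it leaves finitely many VALUES `W`.  (E6) `arch_finite` (§5):
a FIXED `W₀ ≠ 0` is a rescaled level value at finitely many `N`: `P = Y^a·Q` (Mathlib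
`exists_eq_pow_rootMultiplicity_mul_and_not_dvd`), `Q(ℓ₂, 0) ≠ 0` by `transcendental_ell2`, continuity `continuous_bev₂`,
`s_N → ℓ₂` (`tendsto_partialSum_two`), `r_N = W₀/2^{sn} → 0` EXACTLY (no unit fudge).  (E7) `far_levels_finite` +
`thinFibreAt_of_sectorCond` (§8): far points by (E1)–(E6), near points (`‖r‖₂ ≤ R₀`) by `den_le_of_level` +
`levels_finite_of_bounded` (this is where non-degeneracy is used), all as bounded level sets ⇒ the clause LITERALLY as
tree `ThinFibreAt m₀` (`|r| ≤ C`, non-degenerate, `C·2^{(N+1)!} < den(r)^{m₀N}` violated only at finitely many `N`).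

## CHECKLIST S (short; the memo NODE-g67.md has the long form)

(S1) farm rc 0, 0 sorry, axioms standard (`lean check --axioms`, g67/out/ax_*.json); (S2) conclusion = tree `ThinFibreAt`
verbatim, VIOLATING := `m₀·(j₂ − j₁) ≤ d₁ − d₂` (critical included); (S3) tie = `level_identity` read ultrametrically
(`ultrametric_tie`), hull clause carried, `layerPoly` sums EVERY monomial `(j, i) ∈ supp` of weight `M − g`; (S4) = (E5);
(S5) = (E6); (S6) = (E3); (S7) `DomZero` only via `den_rescaled_le`/`den_le_of_level`/`c_zero_ne_zero`; (S8) HONESTY below.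

## HONESTY (rung 0)

FIRST ORDER: one Newton step + one constant correction.  Nothing here proves Schanuel, `FiniteOrderLiouvilleSchanuel`
(33364), 33363, 31077, 31987, the uniform `ThinFibre 2`, `W4P`, or any binder (`PadicSubspace` untouched: ρ1 is a
genuine Subspace member and is NOT decided here; ρ2 needs a second-order root separation; ρ3 a second Newton step —
toolkit homework under K-R58 (i), never a witness).  `Residue 2` is NON-EMPTY and TYPED; its three strata are
exhibited by PROVED membership, not by prose.  `LevelFinite` is claimed only at `SectorCond 0` (every hull slope good).
-/

noncomputable section

namespace Summit.Schanuel.Schanuel.Theorems.RootDecomp1KSectorTheorem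

open Polynomial LiouvilleNumber
open scoped Nat
open Summit.Schanuel.Schanuel.Theorems.RootDecomp1KTwoBaseCell (psNumer partialSum_eq_psNumer_div coprime_psNumer)
open Summit.Schanuel.Schanuel.Theorems.RootDecomp1KRelLiouvilleCell (partialSum_two_strictMono
  abs_liouvilleNumber_two_sub_partialSum)
open Summit.Schanuel.Schanuel.Theorems.RootDecomp1KDegreeLadder
open Summit.Schanuel.Schanuel.Theorems.RootDecomp1KXLinear (xLinP bev_xLinP norm_ratCast_two norm_ratCast_of_le
  norm_psNumer_sub_one)
open Summit.Schanuel.Schanuel.Theorems.RootDecomp1KDigitPincer (xc XP X6P)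
open Summit.Schanuel.Schanuel.Theorems.RootDecomp1KOddEmpty (W4P w4C vG natDegree_vG)
open Summit.Schanuel.Schanuel.Theorems.RootDecomp1KHyperellipticSiegel (mQ mC mC_zero mC_one mC_two natDegree_mQ
  coeff_mQ_five leadingCoeff_mQ)
open Summit.Schanuel.Schanuel.Theorems.RootDecomp1KXLinearII (norm_aeval_le norm_psNumer)
open Summit.Schanuel.Schanuel.Theorems.RootDecomp1KXTop
open Summit.Schanuel.Schanuel.Theorems.RootDecomp1KXAll
open Summit.Schanuel.Schanuel.Theorems.RootDecomp1KLevelFinite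
open Summit.Schanuel.Schanuel.Theorems.RootDecomp1KLocalExponent
open Summit.Schanuel.Schanuel.Theorems.RootDecomp1KIntegrality

/-! ## §1  The typed objects: weights, the edge polynomial, the edge data, the sector condition, the residue -/

/-- the largest `Y`-degree among the `x`-coefficients `c_0, …, c_k`. -/
def dMax (k : ℕ) (c : ℕ → ℤ[X]) : ℕ := (Finset.range (k + 1)).sup fun j => (c j).natDegree

/-- the box of exponents `(j, i)` (`x^j · Y^i`) that can occur in `xPolyP k c`. -/
def box (k : ℕ) (c : ℕ → ℤ[X]) : Finset (ℕ × ℕ) := Finset.range (k + 1) ×ˢ Finset.range (dMax k c + 1)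

/-- the SUPPORT of `P = xPolyP k c`: the exponents `(j, i)` of the monomials `x^j·Y^i` with `a_{ji} = (c j).coeff i ≠ 0`. -/
def supp (k : ℕ) (c : ℕ → ℤ[X]) : Finset (ℕ × ℕ) := (box k c).filter (fun p => (c p.1).coeff p.2 ≠ 0)

/-- **the LAYER POLYNOMIALS** of the `(∞,∞)`-segment of slope `s/q` with top weight `M`:
`f_g(W) = Σ_{(j,i) ∈ supp : q·j + s·i + g = M} a_{ji} · W^i` collects the monomials of WEIGHT `q·j + s·i = M − g`
(`g` = the depth below the edge).  `f_0` is **the EDGE POLYNOMIAL** `f`. -/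
def layerPoly (k : ℕ) (c : ℕ → ℤ[X]) (s q M g : ℕ) : ℤ[X] :=
  ∑ p ∈ (supp k c).filter (fun p => q * p.1 + s * p.2 + g = M), C ((c p.1).coeff p.2) * X ^ p.2

/-- [auxiliary predicate] (parameters, NOT a fact): **`M` is the TOP WEIGHT of the slope `s/q`**: every monomial of `P` weighs at most `M` and the edge polynomial
`f = f_0` (weight exactly `M`) is non-zero. -/
def TopWeight (k : ℕ) (c : ℕ → ℤ[X]) (s q M : ℕ) : Prop :=
  (∀ p ∈ supp k c, q * p.1 + s * p.2 ≤ M) ∧ layerPoly k c s q M 0 ≠ 0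

/-- [auxiliary predicate] (parameters, NOT a fact): **a root `β` of the edge polynomial is GOOD for the slope `s/q`** (one Newton step + one correction decide it) if
(I) `β ∉ ℚ₂` (closed range), or (C, crude) for some depth `L` the layers `f_1, …, f_{L−1}` vanish IDENTICALLY and the
multiplicity `μ_β` satisfies `μ_β·s < L` and `μ_β·s < q`, or (R, refined — ONE CONSTANT CORRECTION ABSORBED) `β` is a
SIMPLE root (`f'(β) ≠ 0`) and for some depth `L` the layers `f_1, …, f_{L−1}` vanish AT `β` (the effective gap
`G_eff(β) = min{g ≥ 1 : f_g(β) ≠ 0} ≥ L`) with `s < L` and `s < q`.  The `q` in `… < q` is the DIGIT CEILING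
`p_N ≡ 1 (mod 2^{N! − (N−1)!})`, `N! − (N−1)! = q·n·(1 − 1/N) < q·n` (node 26's second-order digit). -/
def RootGood (k : ℕ) (c : ℕ → ℤ[X]) (s q M : ℕ) (β : PadicAlgCl 2) : Prop :=
  (∀ y : ℚ_[2], algebraMap ℚ_[2] (PadicAlgCl 2) y ≠ β) ∨
  (∃ L : ℕ, (∀ g, 1 ≤ g → g < L → layerPoly k c s q M g = 0) ∧
    rootMult (layerPoly k c s q M 0) β * s < L ∧ rootMult (layerPoly k c s q M 0) β * s < q) ∨
  (aeval β (derivative (layerPoly k c s q M 0)) ≠ 0 ∧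
    ∃ L : ℕ, (∀ g, 1 ≤ g → g < L → aeval β (layerPoly k c s q M g) = 0) ∧ s < L ∧ s < q)

/-- [auxiliary predicate] (parameters, NOT a fact): **the slope `s/q` is GOOD**: for its top weight `M`, every NON-ZERO root `β ∈ ℂ₂` of the edge polynomial is good
(`β = 0` is never nearest to a rescaled level point, which is a `2`-adic unit up to `2^{±V}` — RELEVANT ROOTS ONLY). -/
def EdgeGood (k : ℕ) (c : ℕ → ℤ[X]) (s q : ℕ) : Prop :=
  ∃ M, TopWeight k c s q M ∧
    ∀ β : PadicAlgCl 2, β ≠ 0 → aeval β (layerPoly k c s q M 0) = 0 → RootGood k c s q M β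

/-- [class] definition (membership predicate with parameters, NOT a fact; census convention): **THE SECTOR
CONDITION at quality `m₀`**: every HULL PAIR of `x`-coefficients `c_{j₁}, c_{j₂}` (`j₁ < j₂ ≤ k`, both
non-zero, `deg c_{j₂} < deg c_{j₁}`, and no leading monomial `x^j·Y^{deg c_j}` weighs more than the pair) whose slope
`s/q = (j₂ − j₁)/(deg c_{j₁} − deg c_{j₂})` is VIOLATING (`m₀·s ≤ q`, the critical slope `1/m₀` INCLUDED) is good. -/
def SectorCond (m₀ k : ℕ) (c : ℕ → ℤ[X]) : Prop :=
  ∀ j₁ j₂, j₁ < j₂ → j₂ ≤ k → c j₁ ≠ 0 → c j₂ ≠ 0 → (c j₂).natDegree < (c j₁).natDegree →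
    m₀ * (j₂ - j₁) ≤ (c j₁).natDegree - (c j₂).natDegree →
    (∀ j, j ≤ k → c j ≠ 0 →
      ((c j₁).natDegree - (c j₂).natDegree) * j + (j₂ - j₁) * (c j).natDegree ≤
        ((c j₁).natDegree - (c j₂).natDegree) * j₁ + (j₂ - j₁) * (c j₁).natDegree) →
    EdgeGood k c (j₂ - j₁) ((c j₁).natDegree - (c j₂).natDegree)

/-- [class] definition (membership predicate with parameters, NOT a fact; census convention): **THE TYPED RESIDUE at
quality `m₀`** (FIRST ORDER: one Newton step + one constant correction) of the presentation
`(k, c)`: the sector condition fails.  INSPECTION RECIPE (finitely many data; `layerPoly_eq_sum` is the tool): list the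
hull pairs `(c_{j₁}, c_{j₂})` and their slopes `s/q = (j₂ − j₁)/(deg c_{j₁} − deg c_{j₂})`; keep the VIOLATING ones
(`m₀·s ≤ q`); for each, the top weight `M = q·j₁ + s·deg c_{j₁}`, the layer polynomials `f_0 = f, f_1, f_2, …`
(`f_g = Σ_{q·j + s·i = M − g} a_{ji}·W^i`, finitely many non-zero), the factorisation of `f` over `ℚ₂` with
multiplicities; a NON-ZERO root `β` of `f` FAILS iff `β ∈ ℚ₂` and neither (C) (`μ_β·s < min(L, q)` with `f_1 … f_{L−1}`
identically zero) nor (R) (`β` simple, `s < min(G_eff(β), q)`, `G_eff(β) = min{g ≥ 1 : f_g(β) ≠ 0}`) holds; the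
presentation is in the residue iff some violating hull pair has a failing root.  THREE STRATA, ONE PROVED MEMBER EACH
(§11): ρ1 SUBSPACE — a simple non-zero `ℚ₂`-root on a violating edge whose first non-vanishing layer correction is
IRRATIONAL: `Y⁴ + x·Y − 17·x²` (`residue_rho1`, `m₀ ≤ 2`; `s/q = 2/4`, `f = W⁴ − 17`, `17^{1/4} ∈ ℚ₂` simple by Hensel,
`f_1 = 0`, `f_2 = W`, `G_eff = 2 = s`; its second Puiseux coefficient `−β²/68` is irrational — a genuine
`p`-adic-Subspace member, NOT decided by any iteration of this engine); ρ2 MULTIPLE — a multiple non-zero `ℚ₂`-root with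
`μ·s ≥ min(L, q)`: `(Y² − 17x)² − x·Y` (`residue_rho2`; `f = (W² − 17)²`, `√17 ∈ ℚ₂`, `μ = 2`, `s/q = 1/2`: `2 < 2`
fails by the DIGIT ceiling, not by a monomial); ρ3 PEELABLE-DEEP — a simple `ℚ₂`-root whose failing correction is
RATIONAL but `x`-DEPENDENT (a second Newton step of programme (a) decides it; toolkit homework, ×0 when decided):
`x² + x·Y² + Y⁵ + 3` (`residue_rho3`; writer NOTE 17 / ADDENDUM L3037 (2): `s/q = 2/5`, `f = W⁵ + 1`, `β = −1`,
`f_1 = W²`, `G_eff = 1`; branch `Y = −x^{2/5} − x^{1/5}/5 + O(1)`).  Among `x`-LINEAR members ρ3 is EMPTY and so is the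
whole residue: `thinFibreAt_xLinear` (§9) decides EVERY `A + x·B`, `deg B + 2 ≤ deg A`, by ONE constant shift (T) —
e.g. the generic `A = Y⁴ + 2Y³`, `B = −17(Y² + 3Y)` (`s = 1 = G_eff` before the shift `Y ↦ Y + 1/2`, (R) with `L = 2`
after it).  `β = 0` never enters (F2): `Y⁴ + Y³ + x(Y² + Y + 1)` (`f = W²(W² + 1)`) satisfies `SectorCond` as it
stands (`sectorCond_beta0_example`). -/
def Residue (m₀ k : ℕ) (c : ℕ → ℤ[X]) : Prop := ¬ SectorCond m₀ k c

/-! ## §2  Helpers -/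

/-- `‖z‖₂ ≤ 1` for integers. -/
theorem norm_intCast_le_one_st (z : ℤ) : ‖(z : PadicAlgCl 2)‖ ≤ 1 := by
  have h1 : (z : PadicAlgCl 2) = algebraMap ℚ_[2] (PadicAlgCl 2) (z : ℚ_[2]) := (map_intCast _ z).symm
  rw [h1, PadicAlgCl.norm_extends]
  exact Padic.norm_int_le_one z

/-- `‖n‖₂ ≤ 1` for naturals. -/
theorem norm_natCast_le_one_st (n : ℕ) : ‖(n : PadicAlgCl 2)‖ ≤ 1 := by
  have h := norm_intCast_le_one_st (n : ℤ)
  rwa [Int.cast_natCast] at h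

/-- `‖m‖₂ = 2^{−v₂(m)}` for a non-zero integer. -/
theorem norm_intCast_eq_zpow {m : ℤ} (hm : m ≠ 0) :
    ‖(m : PadicAlgCl 2)‖ = (2 : ℝ) ^ (-(padicValInt 2 m : ℤ)) := by
  have hQ : ((m : ℚ) : PadicAlgCl 2) = (m : PadicAlgCl 2) := by push_cast; rfl
  have hm' : (m : ℚ) ≠ 0 := by exact_mod_cast hm
  rw [← hQ, norm_ratCast_two hm', padicValRat.of_int]

/-- `‖2^t‖₂ = 2^{−t}` as an integer power. -/
theorem norm_two_pow_zpow (t : ℕ) : ‖(2 : PadicAlgCl 2) ^ t‖ = (2 : ℝ) ^ (-(t : ℤ)) := by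
  rw [norm_two_pow_Cp, zpow_neg, zpow_natCast, one_div, inv_pow]

/-- **the ultrametric TIE**: in an ultrametric normed field, a finite family summing to zero with a non-zero member
has two DISTINCT members of equal norm dominating all the others. -/
theorem ultrametric_tie {ι : Type*} (s : Finset ι) (f : ι → PadicAlgCl 2) (hsum : ∑ i ∈ s, f i = 0)
    {i₀ : ι} (hi₀ : i₀ ∈ s) (hf : f i₀ ≠ 0) :
    ∃ i₁ ∈ s, ∃ i₂ ∈ s, i₁ ≠ i₂ ∧ f i₁ ≠ 0 ∧ ‖f i₁‖ = ‖f i₂‖ ∧ ∀ i ∈ s, ‖f i‖ ≤ ‖f i₁‖ := by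
  classical
  obtain ⟨i₁, hi₁, hmax⟩ := Finset.exists_max_image s (fun i => ‖f i‖) ⟨i₀, hi₀⟩
  have hf₁ : f i₁ ≠ 0 := by
    intro h0
    have := hmax i₀ hi₀
    rw [h0, norm_zero] at this
    exact hf (norm_le_zero_iff.mp this)
  have hsplit : f i₁ = -∑ i ∈ s.erase i₁, f i := by
    have h := Finset.add_sum_erase s f hi₁
    rw [hsum] at h
    linear_combination h
  have hne : (s.erase i₁).Nonempty := by
    rw [Finset.nonempty_iff_ne_empty]
    intro he
    rw [he, Finset.sum_empty, neg_zero] at hsplit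
    exact hf₁ hsplit
  obtain ⟨i₂, hi₂, hle⟩ := IsUltrametricDist.exists_norm_finsetSum_le_of_nonempty hne f
  have hi₂s : i₂ ∈ s := Finset.mem_of_mem_erase hi₂
  have hne₁₂ : i₁ ≠ i₂ := fun h => Finset.ne_of_mem_erase hi₂ h.symm
  refine ⟨i₁, hi₁, i₂, hi₂s, hne₁₂, hf₁, le_antisymm ?_ (hmax i₂ hi₂s), hmax⟩
  calc ‖f i₁‖ = ‖∑ i ∈ s.erase i₁, f i‖ := by rw [hsplit, norm_neg]
    _ ≤ ‖f i₂‖ := hle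

/-- the level identity summed over ALL indices: `Σ_{j ≤ k} p_N^j · 2^{(k−j)N!} · c_j(r) = 0` in `ℂ₂`. -/
theorem level_identity_sum (k : ℕ) (c : ℕ → ℤ[X]) (N : ℕ) (r : ℚ)
    (hP : bev (xPolyP k c) (partialSum 2 N) r = 0) :
    ∑ j ∈ Finset.range (k + 1), (psNumer 2 N : PadicAlgCl 2) ^ j * 2 ^ ((k - j) * N !) *
      aeval (r : PadicAlgCl 2) (c j) = 0 := by
  rw [Finset.sum_range_succ, Nat.sub_self, zero_mul, pow_zero, mul_one, level_identity k c N r hP]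
  ring

/-! ## §3  The point `(∞,∞)`: the ultrametric TIE names the slope EXACTLY -/

/-- root data of every `x`-coefficient at once (empty data for the zero ones): the factorisation
`c_j(z) = lc(c_j) · Π_β (z − β)^{n_j β}` over `ℂ₂`. -/
theorem roots_data_all (c : ℕ → ℤ[X]) :
    ∃ (T : ℕ → Finset (PadicAlgCl 2)) (n : ℕ → PadicAlgCl 2 → ℕ), ∀ j, c j ≠ 0 →
      (∑ β ∈ T j, n j β = (c j).natDegree) ∧
      ∀ z : PadicAlgCl 2, aeval z (c j) = ((c j).leadingCoeff : PadicAlgCl 2) * ∏ β ∈ T j, (z - β) ^ n j β := by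
  classical
  have h : ∀ j, ∃ (T : Finset (PadicAlgCl 2)) (n : PadicAlgCl 2 → ℕ), c j ≠ 0 →
      (∑ β ∈ T, n β = (c j).natDegree) ∧
      ∀ z : PadicAlgCl 2, aeval z (c j) = ((c j).leadingCoeff : PadicAlgCl 2) * ∏ β ∈ T, (z - β) ^ n β := by
    intro j
    by_cases hj : c j = 0
    · exact ⟨∅, fun _ => 0, fun h => (h hj).elim⟩
    · obtain ⟨T, n, -, -, -, hsum, hprod⟩ := roots_data_mult (c j) hj
      exact ⟨T, n, fun _ => ⟨hsum, hprod⟩⟩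
  choose T n hT using h
  exact ⟨T, n, hT⟩

/-- beyond all roots, `‖c_j(z)‖ = ‖lc(c_j)‖ · ‖z‖^{deg c_j}`. -/
theorem norm_aeval_far {B : ℤ[X]} {T : Finset (PadicAlgCl 2)} {n : PadicAlgCl 2 → ℕ}
    (hsum : ∑ β ∈ T, n β = B.natDegree)
    (hprod : ∀ z : PadicAlgCl 2, aeval z B = (B.leadingCoeff : PadicAlgCl 2) * ∏ β ∈ T, (z - β) ^ n β)
    {z : PadicAlgCl 2} (hz : ∀ β ∈ T, ‖β‖ < ‖z‖) :
    ‖aeval z B‖ = ‖(B.leadingCoeff : PadicAlgCl 2)‖ * ‖z‖ ^ B.natDegree := by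
  have hfac : ∀ β ∈ T, ‖z - β‖ ^ n β = ‖z‖ ^ n β := by
    intro β hβ
    have hne : ‖z‖ ≠ ‖-β‖ := by rw [norm_neg]; exact ne_of_gt (hz β hβ)
    rw [sub_eq_add_neg, IsUltrametricDist.norm_add_eq_max_of_norm_ne_norm hne, norm_neg,
      max_eq_left (hz β hβ).le]
  rw [hprod, norm_mul, norm_prod]
  simp only [norm_pow]
  rw [Finset.prod_congr rfl hfac, Finset.prod_pow_eq_pow_sum, hsum]

/-- `2^a < 2^b ↔ a < b` and friends for real powers of two (integer exponents). -/
theorem two_zpow_lt_iff {a b : ℤ} : (2 : ℝ) ^ a < (2 : ℝ) ^ b ↔ a < b :=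
  zpow_lt_zpow_iff_right₀ (by norm_num)

/-- `{a b : ℤ} : (2 : ℝ) ^ a ≤ (2 : ℝ) ^ b ↔ a ≤ b`. -/
theorem two_zpow_le_iff {a b : ℤ} : (2 : ℝ) ^ a ≤ (2 : ℝ) ^ b ↔ a ≤ b :=
  zpow_le_zpow_iff_right₀ (by norm_num)

/-- `{a b : ℤ} (h : (2 : ℝ) ^ a = (2 : ℝ) ^ b) : a = b`. -/
theorem two_zpow_inj {a b : ℤ} (h : (2 : ℝ) ^ a = (2 : ℝ) ^ b) : a = b :=
  zpow_right_injective₀ (by norm_num) (by norm_num) h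

end Summit.Schanuel.Schanuel.Theorems.RootDecomp1KSectorTheorem
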